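import Summits.Ventures.CertifiedManyBodySolver.Observables.PhaseSeparationExclusionBox
import Literature.MathematicalPhysics.QuantumLattice.HubbardTTPrimeThermalPhaseCoexistenceCanonicalSuperSegment
import HarnessLib

/-!
# Ventures/CertifiedManyBodySolver — Observables/PhaseSeparationExclusionBoxThermal.lean

HONEST FRAMING: the `T > 0` reading of the «competing orders» word of `Observables/PhaseSeparationExclusionBox.lean` — EXCLUSION of
MACROSCOPIC PHASE COEXISTENCE (a phase of density `≤ n₁` with a phase of density `≥ n₂`) in CANONICAL THERMAL torus-limit states
(sector Gibbs states) on a `(t′, U)` CELL of a material box, for every inverse temperature `β` above an explicit threshold set by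
the `T = 0` margin; CONTROL class; conditional on the rows the instances name; the entropy allowance is the crude `log 4` per site
(no low-temperature improvement claimed); nothing about stripes / finite-period states, about which phase is realised, or about
superconductivity; no number of record. Zero compute, no definition, no claim node, no `sorry`.

Cell `pub/hubbard-downfold` (MO-S1 ↔ S2 seam «box ↦ one word»; D-0096 (ii)+(iii): `T > 0` × competing orders), seat
`hubbard-downfold-unc-2` (`prover-hubbard-downfold-unc-2-g19-0`). Law: `not_isTorusLimitOfMixture_mix_of_energyWindows_of_le`
(`Literature/…/HubbardTTPrimeThermalPhaseCoexistenceCanonicalSuperSegment.lean`, this seat; on top of hubbard-thermal's canonical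
coexistence file): a ground-state energy cap at the mean density and floors at `n₁, n₂` with margin `M` exclude the coexistence at
every `β > 2 log 2 / M` (pressure window `−βe ≤ p ≤ 2H_b − βe`). This file transports it over a cell exactly as the `T = 0` column forms:
* `chord_ge_of_ends_ge` — a `U`-chord of two numbers `≥ m` is `≥ m`;
* `psT_not_thermal_mix_on_cell_of_fns` — the cell sentence from a cap function and two floor functions with `2 log 2 < β·margin`
  everywhere on the cell;
* `psT_not_thermal_mix_on_cell_of_columns` — COLUMN FORM: cap affine in `U`, two `n₂`-column laws, a dilute floor `F₁(s)`, both
  column margins `≥ m` on `[s₁, s₂]`, and `2 log 2 < β m` ⇒ the thermal exclusion on the whole cell `[s₁, s₂] × [U₁, U₂]`;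
* `psT_not_thermal_mix_above_column` — one column law + cap non-decreasing in `U`, far-end margin `≥ m`.
Instances: `Downfold/BoxesLa214V115M2cPhaseSeparationThermal.lean` (LSCO `x = 1/8` cells around `U = 8`, `β ≥ 40 … 77`).
References: R. B. Israel, *Convexity in the Theory of Lattice Gases* (1979) Thm I.2.4 [Israel1979]; D. Ruelle, *Statistical
Mechanics* (1969) §3.3 [Ruelle1969]; V. J. Emery, S. A. Kivelson, H. Q. Lin, PRL 64 (1990) 475 [EmeryKivelsonLin1990].
-/

noncomputable section

namespace Summit.Ventures.CertifiedManyBodySolver.Observables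

open Literature.MathematicalPhysics.QuantumLattice Literature.MathematicalPhysics.QuantumLattice.ThermodynamicLimit
open Literature.MathematicalPhysics.QuantumLattice.InfVolFermionState Set Filter

/-- **A chord of two numbers `≥ m` is `≥ m`** (`U₁ < U₂`, `U ∈ [U₁, U₂]`). [folklore] -/
theorem chord_ge_of_ends_ge {U₁ U₂ U g₁ g₂ m : ℝ} (h12 : U₁ < U₂) (hU : U ∈ Icc U₁ U₂) (h₁ : m ≤ g₁) (h₂ : m ≤ g₂) :
    m ≤ ((U₂ - U) * g₁ + (U - U₁) * g₂) / (U₂ - U₁) := by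
  have hd : 0 < U₂ - U₁ := sub_pos.2 h12
  rw [le_div_iff₀ hd]
  have k1 := mul_le_mul_of_nonneg_left h₁ (sub_nonneg.2 hU.2)
  have k2 := mul_le_mul_of_nonneg_left h₂ (sub_nonneg.2 hU.1)
  nlinarith

/-- **THERMAL PS EXCLUSION ON A CELL from three bound functions.** Cell `[s₁, s₂] × [U₁, U₂]` (`U₁ ≥ 0`), `β > 0`, densities
`0 ≤ n₁ < n₂ < 2`, weights `a, b ≥ 0`, `a + b = 1`; a cap function `C` at `a n₁ + b n₂` and floor functions `F₁, F₂` at `n₁, n₂` (bounds on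
the GROUND-STATE energy density) valid on the cell, with `2 log 2 < β·(a F₁ + b F₂ − C)` everywhere on the cell. Then at every `(s, U)` of
the cell no mixture `λω₁ + (1−λ)ω₂` (`0 < λ < 1`) of translation-invariant states with `0 < ρ(ω₁) ≤ n₁`, `n₂ ≤ ρ(ω₂) < 2` is a canonical
thermal torus-limit state at `(β; t, s, U; n)`, for any `0 < n < 2`. [cite: Israel1979, Thm. I.2.4] [cite: Ruelle1969, §3.3] -/
theorem psT_not_thermal_mix_on_cell_of_fns (t : ℝ) {s₁ s₂ U₁ U₂ n₁ n₂ a b β : ℝ} (hU₁ : 0 ≤ U₁) (hβ : 0 < β)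
    (hn₁ : 0 ≤ n₁) (hn : n₁ < n₂) (hn₂ : n₂ < 2) (ha : 0 ≤ a) (hb : 0 ≤ b) (hab : a + b = 1) {C F₁ F₂ : ℝ → ℝ → ℝ}
    (hC : ∀ s ∈ Icc s₁ s₂, ∀ U ∈ Icc U₁ U₂, energyDensityTT' t s U (a * n₁ + b * n₂) ≤ C s U)
    (hF₁ : ∀ s ∈ Icc s₁ s₂, ∀ U ∈ Icc U₁ U₂, F₁ s U ≤ energyDensityTT' t s U n₁)
    (hF₂ : ∀ s ∈ Icc s₁ s₂, ∀ U ∈ Icc U₁ U₂, F₂ s U ≤ energyDensityTT' t s U n₂)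
    (hpos : ∀ s ∈ Icc s₁ s₂, ∀ U ∈ Icc U₁ U₂, 2 * Real.log 2 < β * (a * F₁ s U + b * F₂ s U - C s U))
    {s : ℝ} (hs : s ∈ Icc s₁ s₂) {U : ℝ} (hU : U ∈ Icc U₁ U₂)
    {ω₁ ω₂ : InfVolFermionState 2} (h₁ : ω₁.IsTranslationInvariant) (h₂ : ω₂.IsTranslationInvariant)
    (hρ₁ : 0 < ω₁.density) (hρ₁' : ω₁.density ≤ n₁) (hρ₂ : n₂ ≤ ω₂.density) (hρ₂' : ω₂.density < 2)
    {n : ℝ} (hn0 : 0 < n) (hn2 : n < 2) {lam : ℝ} (hl0 : 0 < lam) (hl1 : lam < 1) {Ls : ℕ → ℕ}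
    (hLs : Tendsto Ls atTop atTop) :
    ¬ (mix lam hl0.le hl1.le ω₁ ω₂).IsTorusLimitOfMixture (sectorGibbsCount n) (fun L => sectorGibbsWeightTT' β t s U n L)
      (fun L => sectorGibbsVectorTT' t s U n L) Ls :=
  not_isTorusLimitOfMixture_mix_of_energyWindows_of_le t s (hU₁.trans hU.1) hβ h₁ h₂ hρ₁ hρ₂' hn₁ hn₂ hρ₁' hn hρ₂ ha hb hab
    (hC s hs U hU) (hF₁ s hs U hU) (hF₂ s hs U hU) (hpos s hs U hU) hn0 hn2 hl0 hl1 hLs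

/-- **THERMAL PS EXCLUSION ON A CELL, COLUMN FORM.** Cell `[s₁, s₂] × [U₁, U₂]` (`0 ≤ U₁ < U₂`), `β > 0`, `0 ≤ n₁ < n₂ < 2`, weights
`a + b = 1`; cap `e(t, s, U, a n₁ + b n₂) ≤ c₀ + c₁·U` on the cell; column laws `L_i(s) ≤ e(t, s, U_i, n₂)`; dilute floor `F₁(s) ≤ e(t, s, U, n₁)`
on the cell; both COLUMN MARGINS `≥ m` on `[s₁, s₂]` and `2 log 2 < β·m`. Then the `(≤ n₁ | ≥ n₂)` coexistence is excluded in every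
canonical thermal state at `(β; t, s, U; n)` for every `(s, U)` of the cell (the margin at `(s, U)` is the `U`-chord of the column
margins, hence `≥ m`). [cite: Israel1979, Thm. I.2.4] [cite: Ruelle1969, §3.3] -/
theorem psT_not_thermal_mix_on_cell_of_columns (t : ℝ) {s₁ s₂ U₁ U₂ n₁ n₂ a b c₀ c₁ β m : ℝ} (hU₁ : 0 ≤ U₁)
    (h12 : U₁ < U₂) (hβ : 0 < β) (hn₁ : 0 ≤ n₁) (hn : n₁ < n₂) (hn₂ : n₂ < 2) (ha : 0 ≤ a) (hb : 0 ≤ b)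
    (hab : a + b = 1) {L₁ L₂ F₁ : ℝ → ℝ}
    (hC : ∀ s ∈ Icc s₁ s₂, ∀ U ∈ Icc U₁ U₂, energyDensityTT' t s U (a * n₁ + b * n₂) ≤ c₀ + c₁ * U)
    (hL₁ : ∀ s ∈ Icc s₁ s₂, L₁ s ≤ energyDensityTT' t s U₁ n₂) (hL₂ : ∀ s ∈ Icc s₁ s₂, L₂ s ≤ energyDensityTT' t s U₂ n₂)
    (hF₁ : ∀ s ∈ Icc s₁ s₂, ∀ U ∈ Icc U₁ U₂, F₁ s ≤ energyDensityTT' t s U n₁)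
    (hm₁ : ∀ s ∈ Icc s₁ s₂, m ≤ a * F₁ s + b * L₁ s - (c₀ + c₁ * U₁))
    (hm₂ : ∀ s ∈ Icc s₁ s₂, m ≤ a * F₁ s + b * L₂ s - (c₀ + c₁ * U₂)) (hβm : 2 * Real.log 2 < β * m)
    {s : ℝ} (hs : s ∈ Icc s₁ s₂) {U : ℝ} (hU : U ∈ Icc U₁ U₂)
    {ω₁ ω₂ : InfVolFermionState 2} (h₁ : ω₁.IsTranslationInvariant) (h₂ : ω₂.IsTranslationInvariant)
    (hρ₁ : 0 < ω₁.density) (hρ₁' : ω₁.density ≤ n₁) (hρ₂ : n₂ ≤ ω₂.density) (hρ₂' : ω₂.density < 2)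
    {n : ℝ} (hn0 : 0 < n) (hn2 : n < 2) {lam : ℝ} (hl0 : 0 < lam) (hl1 : lam < 1) {Ls : ℕ → ℕ}
    (hLs : Tendsto Ls atTop atTop) :
    ¬ (mix lam hl0.le hl1.le ω₁ ω₂).IsTorusLimitOfMixture (sectorGibbsCount n) (fun L => sectorGibbsWeightTT' β t s U n L)
      (fun L => sectorGibbsVectorTT' t s U n L) Ls := by
  have hn2' : 0 ≤ n₂ := hn₁.trans hn.le
  refine psT_not_thermal_mix_on_cell_of_fns t hU₁ hβ hn₁ hn hn₂ ha hb hab (C := fun _ U => c₀ + c₁ * U)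
    (F₁ := fun s _ => F₁ s) (F₂ := fun s U => ((U₂ - U) * L₁ s + (U - U₁) * L₂ s) / (U₂ - U₁)) hC hF₁
    (floor_on_cell_of_columnLaws t hn2' hn₂ hU₁ h12 hL₁ hL₂) ?_ hs hU h₁ h₂ hρ₁ hρ₁' hρ₂ hρ₂' hn0 hn2 hl0 hl1 hLs
  intro s hs U hU
  have hge := chord_ge_of_ends_ge h12 hU (hm₁ s hs) (hm₂ s hs)
  have hd : (U₂ - U₁) ≠ 0 := (sub_pos.2 h12).ne'
  have hid : a * F₁ s + b * (((U₂ - U) * L₁ s + (U - U₁) * L₂ s) / (U₂ - U₁)) - (c₀ + c₁ * U) =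
      ((U₂ - U) * (a * F₁ s + b * L₁ s - (c₀ + c₁ * U₁)) + (U - U₁) * (a * F₁ s + b * L₂ s - (c₀ + c₁ * U₂))) /
        (U₂ - U₁) := by
    field_simp
    ring
  have hM : m ≤ a * F₁ s + b * (((U₂ - U) * L₁ s + (U - U₁) * L₂ s) / (U₂ - U₁)) - (c₀ + c₁ * U) := hid ▸ hge
  have k := mul_le_mul_of_nonneg_left hM hβ.le
  show 2 * Real.log 2 < β * (a * F₁ s + b * (((U₂ - U) * L₁ s + (U - U₁) * L₂ s) / (U₂ - U₁)) - (c₀ + c₁ * U))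
  linarith

/-- **THERMAL PS EXCLUSION ABOVE A COLUMN.** For `U ∈ [U₂, U₃]` (`U₂ ≥ 0`), `β > 0`: a cap `e(t, s, U, a n₁ + b n₂) ≤ c₀ + c₁·U` with
`c₁ ≥ 0`, ONE column law `L(s) ≤ e(t, s, U₂, n₂)`, a dilute floor `F₁(s)` on the cell, the FAR-END margin
`a F₁(s) + b L(s) − (c₀ + c₁U₃) ≥ m` for every `s`, and `2 log 2 < β m`: the coexistence is excluded on the whole cell.
[cite: Israel1979, Thm. I.2.4] [cite: Griffiths1966, §II] -/
theorem psT_not_thermal_mix_above_column (t : ℝ) {s₁ s₂ U₂ U₃ n₁ n₂ a b c₀ c₁ β m : ℝ} (hU₂ : 0 ≤ U₂)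
    (hc₁ : 0 ≤ c₁) (hβ : 0 < β) (hn₁ : 0 ≤ n₁) (hn : n₁ < n₂) (hn₂ : n₂ < 2) (ha : 0 ≤ a) (hb : 0 ≤ b)
    (hab : a + b = 1) {L F₁ : ℝ → ℝ}
    (hC : ∀ s ∈ Icc s₁ s₂, ∀ U ∈ Icc U₂ U₃, energyDensityTT' t s U (a * n₁ + b * n₂) ≤ c₀ + c₁ * U)
    (hL : ∀ s ∈ Icc s₁ s₂, L s ≤ energyDensityTT' t s U₂ n₂)
    (hF₁ : ∀ s ∈ Icc s₁ s₂, ∀ U ∈ Icc U₂ U₃, F₁ s ≤ energyDensityTT' t s U n₁)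
    (hm : ∀ s ∈ Icc s₁ s₂, m ≤ a * F₁ s + b * L s - (c₀ + c₁ * U₃)) (hβm : 2 * Real.log 2 < β * m)
    {s : ℝ} (hs : s ∈ Icc s₁ s₂) {U : ℝ} (hU : U ∈ Icc U₂ U₃)
    {ω₁ ω₂ : InfVolFermionState 2} (h₁ : ω₁.IsTranslationInvariant) (h₂ : ω₂.IsTranslationInvariant)
    (hρ₁ : 0 < ω₁.density) (hρ₁' : ω₁.density ≤ n₁) (hρ₂ : n₂ ≤ ω₂.density) (hρ₂' : ω₂.density < 2)
    {n : ℝ} (hn0 : 0 < n) (hn2 : n < 2) {lam : ℝ} (hl0 : 0 < lam) (hl1 : lam < 1) {Ls : ℕ → ℕ}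
    (hLs : Tendsto Ls atTop atTop) :
    ¬ (mix lam hl0.le hl1.le ω₁ ω₂).IsTorusLimitOfMixture (sectorGibbsCount n) (fun L => sectorGibbsWeightTT' β t s U n L)
      (fun L => sectorGibbsVectorTT' t s U n L) Ls := by
  have hn2' : 0 ≤ n₂ := hn₁.trans hn.le
  refine psT_not_thermal_mix_on_cell_of_fns t hU₂ hβ hn₁ hn hn₂ ha hb hab (C := fun _ U => c₀ + c₁ * U)
    (F₁ := fun s _ => F₁ s) (F₂ := fun s _ => L s) hC hF₁
    (fun s hs U hU => floor_above_column_of_law t hn2' hn₂ hU₂ hL s hs U hU.1) ?_ hs hU h₁ h₂ hρ₁ hρ₁' hρ₂ hρ₂'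
    hn0 hn2 hl0 hl1 hLs
  intro s hs U hU
  have k := mul_le_mul_of_nonneg_left hU.2 hc₁
  have hM : m ≤ a * F₁ s + b * L s - (c₀ + c₁ * U) := by have := hm s hs; linarith
  have k2 := mul_le_mul_of_nonneg_left hM hβ.le
  show 2 * Real.log 2 < β * (a * F₁ s + b * L s - (c₀ + c₁ * U))
  linarith

end Summit.Ventures.CertifiedManyBodySolver.Observables
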